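import Summits.Ventures.YMGap.FlowData.TubePolyakovLine
import Summits.Ventures.YMGap.FlowData.TubeFluxGap
import HarnessLib

/-!
# Venture YMGap, track Y3 FLOW-DATA — NO AXIAL FLUX SECTOR OF THE TUBE TRANSFER OPERATOR IS ANNIHILATED:
# `0 < ‖T ∘ P_{ê_μ}‖`, hence `E₁ > 0` HYPOTHESIS-FREE for the `SU(2)` tube at every `β ≠ 0` (theorems only)

HONEST FRAMING: venture file of the cell `pub-ymgap` (QuantumFields programme), track Y3; companion THEOREMS for
`FlowData/TorelonEnergy.lean` / `TubeFluxGap.lean` (lead R237 (c) D-item).  `TubeFluxGap.su2TorelonEnergy_pos`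
proves `E₁ > 0` on every finite tube PROVIDED the flux sector along the axis is not annihilated by the transfer
operator (`0 < ‖T ∘ P_{ê_μ}‖`); this file discharges that proviso.  Finite spatial torus `(ℤ/L)^k`, any `k ≥ 1`,
`L ≥ 1`; no number, no row, nothing about `L → ∞`, the continuum, confinement or a mass gap.

THE WITNESS (Polyakov / torelon line state).  Let `ℓ_μ = {(t ê_μ, μ) : t = 0,…,L−1}` be the straight line of
`μ`-links winding the `μ`-cycle once, `W(b) = Re tr ρ(∏ₜ b(t ê_μ, μ))` its holonomy trace and
`ψ(b) = e^{−J mag(b)/2} W(b) ∈ L²`.  Then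
* `W` is gauge invariant and continuous, and under the centre twist `C_s` it picks up `χ_{ê_μ}(s) = (−1)^{s_μ}`
  when `ρ(z) = −1` (`prod_ofFn_line_fluxTwist`), so `C_s ψ = χ_{ê_μ}(s) ψ` and **`P_{ê_μ} ψ = ψ`**
  (`tubeFluxProjection_apply_of_twist_eigen`);
* **`inner_tubeTransferOperator_pathState`** (stated for any injective link family `ℓ : Fin m → links` with a
  gauge-invariant trace, e.g. a closed lattice path): `⟪ψ, T ψ⟫ = c₀^{N−m} λ^m ∫ W²`, where `c₀ = ∫ e^{J Re tr ρ}`,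
  `N = k L^k` is the number of links and `λ` the Schur scalar `∫ e^{J Re tr ρ(c)} ρ(c)_{ij} dc = λ δ_{ij}` — the
  temporal links are gauged away against the gauge-invariant `W` (`integral_integral_exp_elecSum_mul`), the links
  off the path integrate to `c₀` each and the path is a Haar chain (`integral_prod_weight_mul_re_trace_line`);
* hence **`tubeSectorNorm_pos_of_pathState`** / **`tubeSectorNorm_single_pos_of_schurScalar`**:
  `λ ≠ 0 ⇒ 0 < ‖T ∘ P_{ê_μ}‖` (`∫ W² > 0` since `W(1) = n ≠ 0`), for every compact second-countable `G`,
  continuous `ρ` with `ρ(z) = −1`, `z` central.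
For `SU(2)`, fundamental `ρ`, `z = −1`, `J = β/2`: `λ/c₀ = u(β) = I₂(β)/I₁(β) ≠ 0` iff `β ≠ 0`
(`PolyakovHaarChain.su2_integral_exp_mul_apply`, Schwinger–Dyson `3u = β⟨sin²⟩`), whence
**`su2_tubeSectorNorm_single_pos`** and the hypothesis-free **`su2TorelonEnergy_pos'`**:
`0 < su2TorelonEnergy β k L μ` for every `k`, `L`, axis `μ` and every `β ≠ 0` — every `E₁` entry of the FLOW-TABLE
is the logarithm of a genuine ratio `λ̂₀/λ̂₀^{(e₁)} > 1`.

References: G. 't Hooft, Nucl. Phys. B 153 (1979) 141 [cite: tHooft1979Flux]; I. Montvay, G. Münster (1994)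
§3.2.6 [cite: MontvayMunster1994, §3.2.6]; M. Reed, B. Simon IV (1978) §XIII.12 [cite: ReedSimonIV1978, §XIII.12].
-/

noncomputable section

open scoped BigOperators ENNReal
open MeasureTheory Filter Function
open Literature.MathematicalPhysics.QuantumFieldTheory Literature.Analysis.OperatorTheory

namespace Summit.Ventures.YMGap.FlowData

/-! ### Twist eigenfunctions lie in their flux sector -/

section Sector

variable {G : Type*} [Group G] [TopologicalSpace G] [IsTopologicalGroup G] [CompactSpace G]
  [MeasurableSpace G] [BorelSpace G] {k L : ℕ} [NeZero L] (z : G)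

/-- **A joint twist eigenfunction with eigenvalues `χ_e(s)` is fixed by `P_e`**:
`C_s ψ = χ_e(s) ψ ∀ s ⇒ P_e ψ = 2^{−k} Σ_s χ_e(s)² ψ = ψ`. [cite: tHooft1979Flux] -/
theorem tubeFluxProjection_apply_of_twist_eigen {e : Fin k → ZMod 2} {ψ : Lp ℝ 2 (sliceMeasure G k L)}
    (hψ : ∀ s : Fin k → ZMod 2, fluxTwistOp k L z s ψ = fluxSign e s • ψ) :
    tubeFluxProjection z k L e ψ = ψ := by
  unfold tubeFluxProjection fluxProjection
  rw [_root_.smul_apply, _root_.sum_apply]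
  simp_rw [_root_.smul_apply, hψ, smul_smul, fluxSign_mul_self, one_smul, Finset.sum_const, Finset.card_univ,
    Fintype.card_fun, ZMod.card, Fintype.card_fin]
  rw [← Nat.cast_smul_eq_nsmul ℝ, smul_smul]
  have h2k : (2 : ℝ) ^ k ≠ 0 := by positivity
  rw [Nat.cast_pow, Nat.cast_ofNat, inv_mul_cancel₀ h2k, one_smul]

/-- **The `L²` class of a pointwise twist eigenfunction is a twist eigenvector**: if `f ∘ twist_s = χ · f` then
`C_s [f] = χ • [f]`. [folklore] -/
theorem fluxTwistOp_toLp_eq_smul (s : Fin k → ZMod 2) {f : GaugeConfig k L G → ℝ}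
    (hf : MemLp f 2 (sliceMeasure G k L)) (χ : ℝ) (hfs : ∀ b, f (fluxTwist z s b) = χ * f b) :
    fluxTwistOp k L z s (hf.toLp f) = χ • hf.toLp f := by
  apply Lp.ext
  have h1 := fluxTwistOp_ae_eq (L := L) z s (hf.toLp f)
  have h2 : ((hf.toLp f : Lp ℝ 2 (sliceMeasure G k L)) : GaugeConfig k L G → ℝ) ∘ fluxTwist z s
      =ᵐ[sliceMeasure G k L] f ∘ fluxTwist z s :=
    (measurePreserving_fluxTwist (L := L) z s).quasiMeasurePreserving.ae_eq_comp hf.coeFn_toLp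
  have h3 : (f ∘ fluxTwist (L := L) z s) = fun b => χ * f b := funext fun b => hfs b
  filter_upwards [h1, h2, Lp.coeFn_smul χ (hf.toLp f), hf.coeFn_toLp] with b hb1 hb2 hb3 hb4
  rw [hb1, hb2, h3, hb3, Pi.smul_apply, hb4, smul_eq_mul]

end Sector

/-! ### The Polyakov-line state and its image under the transfer operator -/

section LineState

variable {G : Type*} [Group G] [TopologicalSpace G] [IsTopologicalGroup G] [CompactSpace G]
  [MeasurableSpace G] [BorelSpace G] [SecondCountableTopology G] {n : ℕ} (ρ : G →* Matrix (Fin n) (Fin n) ℂ)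
  (J : ℝ) {k L : ℕ} [NeZero L]

omit [TopologicalSpace G] [IsTopologicalGroup G] [CompactSpace G] [MeasurableSpace G] [BorelSpace G]
  [SecondCountableTopology G] [NeZero L] in
/-- The straight line `t ↦ (t ê_μ, μ)`, `t < L`, consists of `L` distinct links. [folklore] -/
theorem line_injective (μ : Fin k) :
    Injective fun t : Fin L => ((Pi.single μ ((t : ℕ) : ZMod L), μ) : Edge k L) := by
  intro t t' h
  have h1 : ((t : ℕ) : ZMod L) = ((t' : ℕ) : ZMod L) := by
    have := congrArg (fun e : Edge k L => e.1 μ) h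
    simpa only [Pi.single_eq_same] using this
  rw [ZMod.natCast_eq_natCast_iff'] at h1
  rw [Nat.mod_eq_of_lt t.2, Nat.mod_eq_of_lt t'.2] at h1
  exact Fin.ext h1

omit [TopologicalSpace G] [IsTopologicalGroup G] [CompactSpace G] [MeasurableSpace G] [BorelSpace G]
  [SecondCountableTopology G] [NeZero L] in
/-- **The holonomy trace of the line is gauge invariant.** [folklore] -/
theorem lineTrace_gaugeTransform (μ : Fin k) (γ : Site k L → G) (b : GaugeConfig k L G) :
    (ρ ((List.ofFn fun t : Fin L => gaugeTransform γ b (Pi.single μ ((t : ℕ) : ZMod L), μ)).prod)).trace.re =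
      (ρ ((List.ofFn fun t : Fin L => b (Pi.single μ ((t : ℕ) : ZMod L), μ)).prod)).trace.re := by
  rw [prod_ofFn_line_gaugeTransform, map_mul, map_mul, Matrix.trace_mul_cycle, ← map_mul, inv_mul_cancel,
    map_one, one_mul]

omit [TopologicalSpace G] [IsTopologicalGroup G] [CompactSpace G] [MeasurableSpace G] [BorelSpace G]
  [SecondCountableTopology G] in
/-- **The holonomy trace of the line is a twist eigenfunction** with eigenvalue `χ_{ê_μ}(s)` when `ρ(z) = −1`.
[cite: tHooft1979Flux] -/
theorem lineTrace_fluxTwist {z : G} (hρz : ρ z = -1) (μ : Fin k) (s : Fin k → ZMod 2) (b : GaugeConfig k L G) :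
    (ρ ((List.ofFn fun t : Fin L => fluxTwist z s b (Pi.single μ ((t : ℕ) : ZMod L), μ)).prod)).trace.re =
      fluxSign (Pi.single μ 1) s *
        (ρ ((List.ofFn fun t : Fin L => b (Pi.single μ ((t : ℕ) : ZMod L), μ)).prod)).trace.re := by
  rw [prod_ofFn_line_fluxTwist, map_mul]
  have hsign : fluxSign (Pi.single μ 1 : Fin k → ZMod 2) s = if s μ = 1 then -1 else 1 := by
    unfold fluxSign
    rw [Finset.prod_eq_single μ]
    · simp only [Pi.single_eq_same, true_and]
    · intro ν _ hν
      simp only [Pi.single_apply, if_neg hν, zero_ne_one, false_and, if_false]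
    · intro h; exact absurd (Finset.mem_univ μ) h
  rw [hsign]
  split_ifs with h
  · rw [hρz, neg_mul, one_mul, Matrix.trace_neg, Complex.neg_re, neg_mul, one_mul]
  · rw [map_one, one_mul, one_mul]

/-- **`⟪ψ, T ψ⟫` for a holonomy-trace state** `ψ(b) = e^{−J mag(b)/2} W(b)`, `W(b) = Re tr ρ(∏ₜ b(ℓ t))` the trace of
the ordered product of the links of an injective family `ℓ : Fin m → links` (a lattice path), ASSUMED gauge invariant:
`⟪ψ, Tψ⟫ = c₀^{N−m} λ^m ∫ W²` (`c₀ = ∫ e^{J Re tr ρ}`, `N` = number of links, `λ` the Schur scalar of the one-link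
weight). [cite: MontvayMunster1994, §3.2.6] -/
theorem inner_tubeTransferOperator_pathState (hρ : Continuous ρ) {lam : ℝ}
    (hM : ∀ i j, ∫ c, (Real.exp (J * (ρ c).trace.re) : ℂ) * ρ c i j ∂haarProbability G = if i = j then (lam : ℂ) else 0)
    {m : ℕ} (ℓ : Fin m → Edge k L) (hℓ : Injective ℓ)
    (hWg : ∀ (γ : Site k L → G) (b : GaugeConfig k L G),
      (ρ ((List.ofFn fun t : Fin m => gaugeTransform γ b (ℓ t)).prod)).trace.re =
        (ρ ((List.ofFn fun t : Fin m => b (ℓ t)).prod)).trace.re)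
    (hmem : MemLp (fun b : GaugeConfig k L G => Real.exp (-(J / 2 * magSum (d := k) (L := L) ρ b)) *
      (ρ ((List.ofFn fun t : Fin m => b (ℓ t)).prod)).trace.re) 2 (sliceMeasure G k L)) :
    @inner ℝ _ _ (hmem.toLp _) (tubeTransferOperator ρ J k L (hmem.toLp _)) =
      (∫ g, Real.exp (J * (ρ g).trace.re) ∂haarProbability G) ^ (Fintype.card (Edge k L) - m) * lam ^ m *
        ∫ b, (ρ ((List.ofFn fun t : Fin m => b (ℓ t)).prod)).trace.re ^ 2 ∂(sliceMeasure G k L) := by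
  set W : GaugeConfig k L G → ℝ := fun b => (ρ ((List.ofFn fun t : Fin m => b (ℓ t)).prod)).trace.re with hW
  set f : GaugeConfig k L G → ℝ := fun b => Real.exp (-(J / 2 * magSum (d := k) (L := L) ρ b)) * W b with hf
  set C : ℝ := (∫ g, Real.exp (J * (ρ g).trace.re) ∂haarProbability G) ^ (Fintype.card (Edge k L) - m) * lam ^ m
    with hC
  have hWc : Continuous W :=
    Complex.continuous_re.comp ((hρ.comp (continuous_prod_ofFn_apply m ℓ)).matrix_trace)
  have hWg' : ∀ (γ : Site k L → G) (b : GaugeConfig k L G), W (gaugeTransform γ b) = W b := fun γ b => hWg γ b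
  -- Step 1: replace the `L²` representatives by the function `f`
  set ψ : Lp ℝ 2 (sliceMeasure G k L) := hmem.toLp _ with hψ
  rw [inner_tubeTransferOperator_eq_integral J k L hρ]
  have hae : (ψ : GaugeConfig k L G → ℝ) =ᵐ[sliceMeasure G k L] f := hmem.coeFn_toLp
  have h1 : ∀ a, ∫ b, sliceKernel (d := k) (L := L) ρ J J a b * ψ b ∂(sliceMeasure G k L) =
      ∫ b, sliceKernel (d := k) (L := L) ρ J J a b * f b ∂(sliceMeasure G k L) := by
    intro a
    refine integral_congr_ae ?_
    filter_upwards [hae] with b hb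
    rw [hb]
  have h2 : (fun a => ψ a * ∫ b, sliceKernel (d := k) (L := L) ρ J J a b * ψ b ∂(sliceMeasure G k L))
      =ᵐ[sliceMeasure G k L] fun a => f a * ∫ b, sliceKernel (d := k) (L := L) ρ J J a b * f b ∂(sliceMeasure G k L) := by
    filter_upwards [hae] with a ha
    rw [ha, h1 a]
  rw [integral_congr_ae h2]
  -- Step 2: the inner integral, `∫ K(a,b) f(b) db = e^{J mag a/2} · C · W a`
  have h3 : ∀ a, ∫ b, sliceKernel (d := k) (L := L) ρ J J a b * f b ∂(sliceMeasure G k L) =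
      Real.exp (J / 2 * magSum (d := k) (L := L) ρ a) * (C * W a) := by
    intro a
    have hK : ∀ b, sliceKernel (d := k) (L := L) ρ J J a b * f b = Real.exp (J / 2 * magSum (d := k) (L := L) ρ a) *
        ((∫ E, Real.exp (J * elecSum (d := k) (L := L) ρ a E b) ∂(Measure.pi fun _ : Site k L => haarProbability G)) *
          W b) := by
      intro b
      simp only [sliceKernel, hf, Real.exp_neg]
      field_simp
    simp_rw [hK]
    rw [integral_const_mul, integral_integral_exp_elecSum_mul ρ J hρ hWc hWg' a]
    congr 1
    have h4 : ∀ c : GaugeConfig k L G, W (c * a) =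
        ((1 : Matrix (Fin n) (Fin n) ℂ) * ρ ((List.ofFn fun t : Fin m => c (ℓ t) * a (ℓ t)).prod) * 1).trace.re := by
      intro c
      simp only [hW, Pi.mul_apply, one_mul, mul_one]
    simp_rw [h4]
    have hw : Continuous fun g : G => Real.exp (J * (ρ g).trace.re) :=
      Real.continuous_exp.comp (continuous_const.mul (Complex.continuous_re.comp hρ.matrix_trace))
    rw [integral_prod_weight_mul_re_trace_line ρ (w := fun g : G => Real.exp (J * (ρ g).trace.re)) hw hρ hM ℓ
      hℓ (fun t => a (ℓ t)) 1 1]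
    simp only [hC, hW, one_mul, mul_one]
  simp_rw [h3]
  -- Step 3: the outer integral
  have h5 : ∀ a, f a * (Real.exp (J / 2 * magSum (d := k) (L := L) ρ a) * (C * W a)) = C * W a ^ 2 := by
    intro a
    simp only [hf, Real.exp_neg]
    field_simp
  simp_rw [h5]
  rw [integral_const_mul]

/-- **A gauge-invariant holonomy-trace state with twist eigenvalues `χ_e(s)` witnesses the sector `e`** (general
form): for continuous `ρ`, `z` central, an injective link family `ℓ : Fin m → links` whose trace `W = Re tr ρ(∏ₜ b(ℓ t))`
is gauge invariant and satisfies `W ∘ twist_s = χ_e(s) W`, and a non-zero Schur scalar `λ` of the one-link weight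
`e^{J Re tr ρ}` (`n ≠ 0`), the tube transfer operator does not annihilate the sector `e`: `0 < ‖T ∘ P_e‖`.
[cite: tHooft1979Flux] -/
theorem tubeSectorNorm_pos_of_pathState (hρ : Continuous ρ) (hn : n ≠ 0) {z : G} (hz : z ∈ Subgroup.center G)
    {lam : ℝ} (hlam : lam ≠ 0)
    (hM : ∀ i j, ∫ c, (Real.exp (J * (ρ c).trace.re) : ℂ) * ρ c i j ∂haarProbability G = if i = j then (lam : ℂ) else 0)
    {m : ℕ} (ℓ : Fin m → Edge k L) (hℓ : Injective ℓ) (e : Fin k → ZMod 2)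
    (hWg : ∀ (γ : Site k L → G) (b : GaugeConfig k L G),
      (ρ ((List.ofFn fun t : Fin m => gaugeTransform γ b (ℓ t)).prod)).trace.re =
        (ρ ((List.ofFn fun t : Fin m => b (ℓ t)).prod)).trace.re)
    (hWs : ∀ (s : Fin k → ZMod 2) (b : GaugeConfig k L G),
      (ρ ((List.ofFn fun t : Fin m => fluxTwist z s b (ℓ t)).prod)).trace.re =
        fluxSign e s * (ρ ((List.ofFn fun t : Fin m => b (ℓ t)).prod)).trace.re) :
    0 < tubeSectorNorm ρ z J k L e := by
  set W : GaugeConfig k L G → ℝ := fun b => (ρ ((List.ofFn fun t : Fin m => b (ℓ t)).prod)).trace.re with hW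
  set f : GaugeConfig k L G → ℝ := fun b => Real.exp (-(J / 2 * magSum (d := k) (L := L) ρ b)) * W b with hf
  have hWc : Continuous W :=
    Complex.continuous_re.comp ((hρ.comp (continuous_prod_ofFn_apply m ℓ)).matrix_trace)
  have hfc : Continuous f :=
    (Real.continuous_exp.comp (continuous_const.mul (continuous_magSum (d := k) (L := L) ρ hρ)).neg).mul hWc
  obtain ⟨Cf, hCf⟩ := isCompact_univ.exists_bound_of_continuousOn hfc.continuousOn
  have hmem : MemLp f 2 (sliceMeasure G k L) :=
    MemLp.of_bound hfc.aestronglyMeasurable Cf (Eventually.of_forall fun b => hCf b (Set.mem_univ _))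
  -- the state lies in the sector `e`
  have heig : ∀ s : Fin k → ZMod 2, fluxTwistOp k L z s (hmem.toLp f) = fluxSign e s • hmem.toLp f := by
    intro s
    refine fluxTwistOp_toLp_eq_smul z s hmem _ fun b => ?_
    have hWs' : W (fluxTwist z s b) = fluxSign e s * W b := hWs s b
    simp only [hf]
    rw [magSum_fluxTwist ρ hz, hWs']
    ring
  have hP : tubeFluxProjection z k L e (hmem.toLp f) = hmem.toLp f :=
    tubeFluxProjection_apply_of_twist_eigen z heig
  -- `⟪ψ, Tψ⟫ ≠ 0`
  have hinner := inner_tubeTransferOperator_pathState ρ J hρ hM ℓ hℓ hWg hmem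
  have hc0 : 0 < ∫ g, Real.exp (J * (ρ g).trace.re) ∂haarProbability G :=
    integral_exp_pos ((Real.continuous_exp.comp (continuous_const.mul
      (Complex.continuous_re.comp hρ.matrix_trace))).integrable_of_hasCompactSupport (HasCompactSupport.of_compactSpace _))
  have hW1 : W 1 = n := by
    have h : (List.ofFn fun t : Fin m => (1 : GaugeConfig k L G) (ℓ t)).prod = 1 := by
      simp only [Pi.one_apply, List.ofFn_const, List.prod_replicate, one_pow]
    simp only [hW, h, map_one, Matrix.trace_one, Fintype.card_fin, Complex.natCast_re]
  have hW2 : 0 < ∫ b, W b ^ 2 ∂(sliceMeasure G k L) := by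
    refine Continuous.integral_pos_of_hasCompactSupport_nonneg_nonzero (x := 1) (hWc.pow 2)
      (HasCompactSupport.of_compactSpace _) (fun b => sq_nonneg _) ?_
    rw [hW1]
    exact pow_ne_zero 2 (Nat.cast_ne_zero.2 hn)
  have hne : @inner ℝ _ _ (hmem.toLp f) (tubeTransferOperator ρ J k L (hmem.toLp f)) ≠ 0 := by
    rw [hinner]
    exact mul_ne_zero (mul_ne_zero (pow_ne_zero _ hc0.ne') (pow_ne_zero _ hlam)) hW2.ne'
  -- conclude
  refine lt_of_le_of_ne (sectorNorm_nonneg _ _ _) fun h0 => hne ?_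
  have hTP : (tubeTransferOperator ρ J k L).comp (tubeFluxProjection z k L e) = 0 := by
    have h := h0.symm
    unfold tubeSectorNorm sectorNorm at h
    exact norm_eq_zero.1 h
  have h := congrArg (fun A => A (hmem.toLp f)) hTP
  simp only [ContinuousLinearMap.comp_apply, hP, _root_.zero_apply] at h
  rw [h, inner_zero_right]

/-- **No axial flux sector is annihilated** (general compact group): for continuous `ρ` with `ρ(z) = −1`, `z`
central, and a non-zero Schur scalar `λ` of the one-link weight `e^{J Re tr ρ}`, `0 < ‖T ∘ P_{ê_μ}‖` — the straight
Polyakov line along `μ` is the witness. [cite: tHooft1979Flux] -/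
theorem tubeSectorNorm_single_pos_of_schurScalar (hρ : Continuous ρ) (hn : n ≠ 0) {z : G}
    (hz : z ∈ Subgroup.center G) (hρz : ρ z = -1) {lam : ℝ} (hlam : lam ≠ 0)
    (hM : ∀ i j, ∫ c, (Real.exp (J * (ρ c).trace.re) : ℂ) * ρ c i j ∂haarProbability G = if i = j then (lam : ℂ) else 0)
    (μ : Fin k) : 0 < tubeSectorNorm ρ z J k L (Pi.single μ 1) :=
  tubeSectorNorm_pos_of_pathState ρ J hρ hn hz hlam hM (fun t : Fin L => (Pi.single μ ((t : ℕ) : ZMod L), μ))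
    (line_injective μ) (Pi.single μ 1) (lineTrace_gaugeTransform ρ μ) (lineTrace_fluxTwist ρ hρz μ)

end LineState

/-! ### The cell's object: `SU(2)`, fundamental representation, `z = −1`, Wilson coupling `β ≠ 0` -/

section SU2

open Literature.MathematicalPhysics.QuantumLattice (fundamentalRep fundamentalRep_apply continuous_fundamentalRep
  secondCountableTopology_su2)
open Summit.Ventures.LatticeQCDFlow.Exactness (su2a0)
open Summit.Ventures.LatticeQCDFlow.Scoring (onePlaquetteZSU2 onePlaquetteExpectSU2 onePlaquetteZSU2_pos
  three_mul_expect_cos_eq_beta_mul_expect_sin_sq_su2)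

/-- `ρ(−1) = −1` for the fundamental representation of `SU(2)`. [folklore] -/
theorem fundamentalRep_su2MinusOne : fundamentalRep (Fin 2) su2MinusOne = -1 := by
  rw [fundamentalRep_apply, coe_su2MinusOne]

/-- **`u(β) ≠ 0` for `β ≠ 0`**: the one-plaquette character ratio `⟨cos α⟩_β` vanishes only at `β = 0`
(Schwinger–Dyson `3⟨cos α⟩ = β⟨sin² α⟩`, `⟨sin² α⟩ > 0`). [folklore] -/
theorem onePlaquetteExpectSU2_cos_ne_zero {β : ℝ} (hβ : β ≠ 0) : onePlaquetteExpectSU2 β Real.cos ≠ 0 := by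
  have hsd := three_mul_expect_cos_eq_beta_mul_expect_sin_sq_su2 β
  have hsin : 0 < onePlaquetteExpectSU2 β (fun α => Real.sin α ^ 2) := by
    unfold onePlaquetteExpectSU2
    refine div_pos ?_ (onePlaquetteZSU2_pos β)
    refine intervalIntegral.intervalIntegral_pos_of_pos_on ?_ (fun x hx => ?_) Real.pi_pos
    · exact (by fun_prop : Continuous fun α => Real.sin α ^ 2 * (Real.sin α ^ 2 * Real.exp (β * Real.cos α))).intervalIntegrable _ _
    · have hs : 0 < Real.sin x := Real.sin_pos_of_pos_of_lt_pi hx.1 hx.2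
      positivity
  intro h0
  rw [h0, mul_zero] at hsd
  exact (mul_ne_zero hβ hsin.ne') hsd.symm

/-- **The Schur scalar of the `SU(2)` Wilson weight at `J = β/2` does not vanish for `β ≠ 0`**:
`λ = (2/π) Z₂(β) u(β) ≠ 0`. [folklore] -/
theorem su2_schurScalar_ne_zero {β : ℝ} (hβ : β ≠ 0) :
    (∫ U : Matrix.specialUnitaryGroup (Fin 2) ℂ, Real.exp (2 * (β / 2) * su2a0 U) * su2a0 U
      ∂haarProbability (Matrix.specialUnitaryGroup (Fin 2) ℂ)) ≠ 0 := by
  rw [su2_schurScalar_eq, show 2 * (β / 2) = β by ring]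
  exact mul_ne_zero (mul_ne_zero (by positivity) (onePlaquetteZSU2_pos β).ne') (onePlaquetteExpectSU2_cos_ne_zero hβ)

/-- **No axial flux sector of the `SU(2)` tube is annihilated**: `0 < ‖T ∘ P_{ê_μ}‖` for the cell's tube transfer
operator (`SU(2)`, fundamental, twist `−1`, `J = β/2`) on `(ℤ/L)^k`, every `k`, `L`, axis `μ`, every `β ≠ 0`.
[cite: tHooft1979Flux] -/
theorem su2_tubeSectorNorm_single_pos {β : ℝ} (hβ : β ≠ 0) (k L : ℕ) [NeZero L] (μ : Fin k) :
    0 < tubeSectorNorm (fundamentalRep (Fin 2)) su2MinusOne (β / 2) k L (Pi.single μ 1) := by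
  haveI : SecondCountableTopology (Matrix.specialUnitaryGroup (Fin 2) ℂ) := secondCountableTopology_su2
  exact tubeSectorNorm_single_pos_of_schurScalar (fundamentalRep (Fin 2)) (β / 2) (continuous_fundamentalRep (Fin 2))
    two_ne_zero su2MinusOne_mem_center fundamentalRep_su2MinusOne (su2_schurScalar_ne_zero hβ)
    (su2_integral_exp_mul_apply (β / 2)) μ

/-- **The cell's torelon energy is strictly positive on every finite tube, hypothesis-free**:
`0 < su2TorelonEnergy β k L μ` for every slice dimension `k`, side `L`, axis `μ` and every Wilson coupling `β ≠ 0`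
— every `E₁` of the FLOW-TABLE is the logarithm of a genuine ratio `‖T‖/‖T ∘ P_{ê_μ}‖ > 1`.  Finite volume only.
[folklore] -/
theorem su2TorelonEnergy_pos' {β : ℝ} (hβ : β ≠ 0) (k L : ℕ) [NeZero L] (μ : Fin k) :
    0 < su2TorelonEnergy β k L μ :=
  su2TorelonEnergy_pos β k L μ (su2_tubeSectorNorm_single_pos hβ k L μ)

end SU2

end Summit.Ventures.YMGap.FlowData
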